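import Summits.Ventures.PercRepro.Night2FatDegSideB
import Summits.Ventures.PercRepro.Night2FatDegCount
import Summits.Ventures.PercRepro.Night2FatDegComb
import Summits.Ventures.PercRepro.Night2FatDegNumLarge
import Summits.Ventures.PercRepro.Night2FatXIndepLevels

/-!
# night-2: the singly degenerate regime for `N ≥ 9` — one side point and two free points

A lossy basis pair of the singly degenerate regime (`hnd₂`, the side points `M = π₃ ∖ L` — collinear or not; the
degeneracy is only needed to PRODUCE the witnesses) with `N = |G ∖ Q| ≥ 9`, a side point `y₃ ∈ W ∖ {x}` and two
FREE points `f₁ ≠ f₂` of `W ∖ {x}` (off `clF M`, on no class basis line coplanar with `M`) has the fair share: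
every target whose `Y` contains `y₃` and one of `f₁, f₂` is unloaded (`dload_eq_zero_of_side_free_deg`), these
number `≥ C(m, k) − C(m − 1, k) − C(m − 3, k − 1)` at level `k + 1` (`choose_le_card_filter_side_family`), and with
level `1` the sum exceeds `1` for `m ≥ 8` (`numeric_deg_large`): **`basis_pair_fair_fat_deg_of_nine_le`**.
Paper `proofs/NIGHT-2-g35.md` §3.
-/

namespace PercRepro.Shadow

open PercRepro.ThmH PercRepro.PerFlat

variable {α : Type*} [DecidableEq α] {M : Matroid α} [M.Finite] {G : Finset α}

omit [DecidableEq α] in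
/-- `fatTerm` is monotone in the capacity (local copy of `fatTerm_le_fatTerm_if`). -/
theorem fatTerm_le_fatTerm_if' (j N : ℕ) :
    fatTerm j (11 / 18) ≤ fatTerm j (if N - j ≤ 3 then 1 else 11 / 18) := by
  unfold fatTerm
  split_ifs
  · apply div_le_div_of_nonneg_right (by norm_num) (by positivity)
  · exact le_rfl

/-- **The fair share of a lossy basis pair with `N ≥ 9`, a side point and two free points** (singly degenerate
regime: the points of `π₂` off the spine have rank `≥ 3`). -/
theorem basis_pair_fair_fat_deg_of_nine_le (hG : G ∈ flatsQ M (5 + 1)) (hd : (gr M \ G).card = 2)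
    (hk : kColoops M G = 1) (hs : ∀ e ∈ gr M, ∀ f ∈ gr M, e ≠ f → rkN M {e, f} = 2)
    (hl : ∀ e ∈ gr M, M.Indep {e}) (hfat : (fatClosures M 5 G 2).card ≤ 1) {B₀ : Finset α}
    (hB₀ : B₀ ∈ thinMembers M 5 G) {w₀ x : α} (hD : G \ clF M B₀ = {w₀, x}) (hne : w₀ ≠ x) {R₁ : Finset α}
    (hR₁V : R₁ ⊆ (G \ coloops M G) \ {w₀, x}) (hR₁2 : rkN M R₁ = 2) (hR₁3 : 3 ≤ R₁.card) {c₂ c₃ : α}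
    (hc₂V : c₂ ∈ (G \ coloops M G) \ {w₀, x}) (hc₃V : c₃ ∈ (G \ coloops M G) \ {w₀, x})
    (hc₂ : c₂ ∉ clF M R₁) (hc₃ : c₃ ∉ clF M (insert c₂ R₁))
    (hcover : ∀ e ∈ (G \ coloops M G) \ {w₀, x}, e ∈ clF M (insert c₂ R₁) ∨ e ∈ clF M (insert c₃ R₁))
    (hnd₂ : 3 ≤ rkN M (((G \ coloops M G) \ {w₀, x}).filter
      (fun e => e ∈ clF M (insert c₂ R₁) ∧ e ∉ clF M R₁)))
    {B : Finset α} (hB : B ∈ thinMembers M 5 G) (hnP : ¬ bigP M G B) {z : α} (hz : z ∈ G \ clF M B)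
    (hl0 : loss M 5 G B z ≠ 0) (hw₀ : w₀ ∈ insert z B) (hx : x ∉ insert z B) (hN : 9 ≤ (G \ insert z B).card)
    {y₃ : α} (hy₃ : y₃ ∈ (G \ insert z B).erase x) (hy₃3 : y₃ ∈ clF M (insert c₃ R₁)) (hy₃L : y₃ ∉ clF M R₁)
    {f₁ f₂ : α} (hf₁ : f₁ ∈ (G \ insert z B).erase x) (hf₂ : f₂ ∈ (G \ insert z B).erase x) (hf₁₂ : f₁ ≠ f₂)
    (hf₁M : f₁ ∉ clF M (((G \ coloops M G) \ {w₀, x}).filter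
      (fun e => e ∈ clF M (insert c₃ R₁) ∧ e ∉ clF M R₁)))
    (hf₂M : f₂ ∉ clF M (((G \ coloops M G) \ {w₀, x}).filter
      (fun e => e ∈ clF M (insert c₃ R₁) ∧ e ∉ clF M R₁)))
    (hf₁' : ∀ a ∈ (insert z B \ coloops M G).erase w₀, ∀ b ∈ (insert z B \ coloops M G).erase w₀, a ≠ b →
      f₁ ∈ clF M {a, b} → rkN M (insert w₀ (insert x {a, b})) ≤ 3 →
      4 ≤ rkN M ({a, b} ∪ ((G \ coloops M G) \ {w₀, x}).filter
        (fun e => e ∈ clF M (insert c₃ R₁) ∧ e ∉ clF M R₁)))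
    (hf₂' : ∀ a ∈ (insert z B \ coloops M G).erase w₀, ∀ b ∈ (insert z B \ coloops M G).erase w₀, a ≠ b →
      f₂ ∈ clF M {a, b} → rkN M (insert w₀ (insert x {a, b})) ≤ 3 →
      4 ≤ rkN M ({a, b} ∪ ((G \ coloops M G) \ {w₀, x}).filter
        (fun e => e ∈ clF M (insert c₃ R₁) ∧ e ∉ clF M R₁))) :
    loss M 5 G B z ≤ rhoL M 5 G B z * lossIncomeH M 5 G (bigP M G) (dshGT2 M 5 G) B z := by
  have hd' : (gr M \ G).card ≤ 5 := by omega
  have hxG : x ∈ G \ insert z B := by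
    refine Finset.mem_sdiff.2 ⟨?_, hx⟩
    have : x ∈ G \ clF M B₀ := by
      rw [hD]
      exact Finset.mem_insert_of_mem (Finset.mem_singleton_self _)
    exact (Finset.mem_sdiff.1 this).1
  set W' := (G \ insert z B).erase x with hW'
  have hW'c : W'.card + 1 = (G \ insert z B).card := by
    rw [hW', Finset.card_erase_of_mem hxG]
    have : 0 < (G \ insert z B).card := Finset.card_pos.2 ⟨x, hxG⟩
    omega
  set U : Finset α := {y₃} with hU
  set V : Finset α := {f₁, f₂} with hV
  have hUW : U ⊆ W' := Finset.singleton_subset_iff.2 hy₃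
  have hVW : V ⊆ W' := Finset.insert_subset hf₁ (Finset.singleton_subset_iff.2 hf₂)
  have hy₃f₁ : y₃ ≠ f₁ := by
    rintro rfl
    apply hf₁M
    -- `y₃` is a side point, hence in `clF M`
    have hy₃x : y₃ ≠ x := (Finset.mem_erase.1 hy₃).1
    have hy₃TQ : y₃ ∈ G \ insert z B := Finset.mem_of_mem_erase hy₃
    have hKQ : coloops M G ⊆ insert z B :=
      (coloops_subset_of_mem_thinMembers hG hd' hB).trans (Finset.subset_insert _ _)
    have hy₃V : y₃ ∈ (G \ coloops M G) \ {w₀, x} := by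
      rw [Finset.mem_sdiff, Finset.mem_sdiff, Finset.mem_insert, Finset.mem_singleton]
      refine ⟨⟨(Finset.mem_sdiff.1 hy₃TQ).1, fun h => (Finset.mem_sdiff.1 hy₃TQ).2 (hKQ h)⟩, ?_⟩
      rintro (rfl | rfl)
      · exact (Finset.mem_sdiff.1 hy₃TQ).2 hw₀
      · exact hy₃x rfl
    have hGg : G ⊆ gr M := (mem_flatsQ.1 hG).1
    exact subset_clF_of_subset_gr (fun e he => hGg (Finset.mem_sdiff.1 (Finset.mem_sdiff.1
      (Finset.mem_filter.1 he).1).1).1) (Finset.mem_filter.2 ⟨hy₃V, hy₃3, hy₃L⟩)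
  have hy₃f₂ : y₃ ≠ f₂ := by
    rintro rfl
    apply hf₂M
    have hy₃x : y₃ ≠ x := (Finset.mem_erase.1 hy₃).1
    have hy₃TQ : y₃ ∈ G \ insert z B := Finset.mem_of_mem_erase hy₃
    have hKQ : coloops M G ⊆ insert z B :=
      (coloops_subset_of_mem_thinMembers hG hd' hB).trans (Finset.subset_insert _ _)
    have hy₃V : y₃ ∈ (G \ coloops M G) \ {w₀, x} := by
      rw [Finset.mem_sdiff, Finset.mem_sdiff, Finset.mem_insert, Finset.mem_singleton]
      refine ⟨⟨(Finset.mem_sdiff.1 hy₃TQ).1, fun h => (Finset.mem_sdiff.1 hy₃TQ).2 (hKQ h)⟩, ?_⟩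
      rintro (rfl | rfl)
      · exact (Finset.mem_sdiff.1 hy₃TQ).2 hw₀
      · exact hy₃x rfl
    have hGg : G ⊆ gr M := (mem_flatsQ.1 hG).1
    exact subset_clF_of_subset_gr (fun e he => hGg (Finset.mem_sdiff.1 (Finset.mem_sdiff.1
      (Finset.mem_filter.1 he).1).1).1) (Finset.mem_filter.2 ⟨hy₃V, hy₃3, hy₃L⟩)
  have hUV : Disjoint U V := by
    rw [hU, hV, Finset.disjoint_singleton_left, Finset.mem_insert, Finset.mem_singleton, not_or]
    exact ⟨hy₃f₁, hy₃f₂⟩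
  have hUc : U.card = 1 := Finset.card_singleton _
  have hVc : V.card = 2 := Finset.card_pair hf₁₂
  -- the family
  set P : Finset α → Prop := fun Y => (Y ∩ U).Nonempty ∧ ((Y ∩ V).Nonempty ∨ 2 ≤ (Y ∩ U).card) with hP
  have hPunload : ∀ T ∈ tgtSets M 5 G B z, x ∈ T → P ((T \ insert z B).erase x) →
      dload M 5 G (bigP M G) (dshGT2 M 5 G) T = 0 := by
    intro T hT hxT hPY
    obtain ⟨⟨u, hu⟩, hrest⟩ := hPY
    rw [Finset.mem_inter, hU, Finset.mem_singleton] at hu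
    obtain ⟨huY, rfl⟩ := hu
    rcases hrest with ⟨f, hf⟩ | h2
    · rw [Finset.mem_inter, hV, Finset.mem_insert, Finset.mem_singleton] at hf
      obtain ⟨hfY, rfl | rfl⟩ := hf
      · exact dload_eq_zero_of_side_free_deg hG hd hk hs hl hfat hB₀ hD hne hR₁V hR₁2 hR₁3 hc₂V hc₃V hc₂ hc₃
          hcover hnd₂ hB hnP hz hw₀ hx hT hxT huY hy₃3 hy₃L hfY hf₁M hf₁'
      · exact dload_eq_zero_of_side_free_deg hG hd hk hs hl hfat hB₀ hD hne hR₁V hR₁2 hR₁3 hc₂V hc₃V hc₂ hc₃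
          hcover hnd₂ hB hnP hz hw₀ hx hT hxT huY hy₃3 hy₃L hfY hf₂M hf₂'
    · exfalso
      have := Finset.card_le_card (Finset.inter_subset_right (s₁ := (T \ insert z B).erase x) (s₂ := U))
      rw [hUc] at this
      omega
  have hcount : ∀ k, W'.card.choose k ≤ ((W'.powersetCard k).filter P).card + (W'.card - 1).choose k +
      (W'.card - 3).choose (k - 1) := by
    intro k
    have := choose_le_card_filter_side_family W' U V hUW hVW hUV k
    rw [hUc, hVc] at this
    rw [show W'.card - 1 - 2 = W'.card - 3 by omega] at this
    simpa using this
  -- the level sums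
  have hlev : ∀ j, 1 ≤ j → (((W'.powersetCard (j - 1)).filter P).card : ℚ) * fatTerm j (11 / 18) ≤
      ∑ T ∈ ((tgtSets M 5 G B z).filter
        (fun T => x ∈ T ∧ dload M 5 G (bigP M G) (dshGT2 M 5 G) T = 0)).filter
        (fun T => (T \ insert z B).card = j),
        capS M 5 G T / ((221 / 360 : ℚ) * ((2 * ((T \ coloops M G).card - 2).choose 4 : ℕ) : ℚ)) := by
    intro j hj
    have h1 := fat_count_level_ge_family hG hd hk hB hnP hz hxG P hj (fun T hT hxT _ hPY => hPunload T hT hxT hPY)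
    have h2 := fatTerm_le_fatTerm_if' j (G \ insert z B).card
    have h0 : (0 : ℚ) ≤ (((W'.powersetCard (j - 1)).filter P).card : ℚ) := by positivity
    calc (((W'.powersetCard (j - 1)).filter P).card : ℚ) * fatTerm j (11 / 18)
        ≤ (((W'.powersetCard (j - 1)).filter P).card : ℚ) *
          fatTerm j (if (G \ insert z B).card - j ≤ 3 then 1 else 11 / 18) := mul_le_mul_of_nonneg_left h2 h0
      _ ≤ _ := h1
  have hg0 : ∀ T ∈ (tgtSets M 5 G B z).filter
      (fun T => x ∈ T ∧ dload M 5 G (bigP M G) (dshGT2 M 5 G) T = 0),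
      0 ≤ capS M 5 G T / ((221 / 360 : ℚ) * ((2 * ((T \ coloops M G).card - 2).choose 4 : ℕ) : ℚ)) :=
    fun T _ => div_nonneg (capS_nonneg' hG hd' T) (by positivity)
  apply basis_pair_fair_of_fat_count_sum hG hd hk hs hl hfat hB₀ hD hne hB hnP hz hl0 hw₀ hx
  have hsum := sum_levels_le_sum hg0 (fun T => (T \ insert z B).card) {1, 3, 4, 5, 6, 7, 8, 9}
  rw [Finset.sum_insert (by decide), Finset.sum_insert (by decide), Finset.sum_insert (by decide),
    Finset.sum_insert (by decide), Finset.sum_insert (by decide), Finset.sum_insert (by decide),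
    Finset.sum_insert (by decide), Finset.sum_singleton] at hsum
  have hl1 := fat_count_level_ge' hG hd hk hB hnP hz hxG (j := 1) (by norm_num)
    (fun T hT _ h1 => dload_eq_zero_of_card_sdiff_le_six hG hd hk hs hl
      (by rw [card_sdiff_coloops_eq_level_add_five hG hd hk hB hnP hz hT, h1]))
  have hc1 : (if (G \ insert z B).card - 1 ≤ 3 then (1 : ℚ) else 11 / 18) = 11 / 18 := by
    rw [if_neg (by omega)]
  rw [hc1] at hl1
  simp only [Nat.sub_self, Nat.choose_zero_right, Nat.cast_one, one_mul] at hl1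
  have hl3 := hlev 3 (by norm_num)
  have hl4 := hlev 4 (by norm_num)
  have hl5 := hlev 5 (by norm_num)
  have hl6 := hlev 6 (by norm_num)
  have hl7 := hlev 7 (by norm_num)
  have hl8 := hlev 8 (by norm_num)
  have hl9 := hlev 9 (by norm_num)
  have hnum := numeric_deg_large W'.card (by omega)
    ((W'.powersetCard 2).filter P).card ((W'.powersetCard 3).filter P).card ((W'.powersetCard 4).filter P).card
    ((W'.powersetCard 5).filter P).card ((W'.powersetCard 6).filter P).card ((W'.powersetCard 7).filter P).card
    ((W'.powersetCard 8).filter P).card (hcount 2) (hcount 3) (hcount 4) (hcount 5) (hcount 6) (hcount 7)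
    (hcount 8)
  simp only [show (3 : ℕ) - 1 = 2 by rfl, show (4 : ℕ) - 1 = 3 by rfl, show (5 : ℕ) - 1 = 4 by rfl,
    show (6 : ℕ) - 1 = 5 by rfl, show (7 : ℕ) - 1 = 6 by rfl, show (8 : ℕ) - 1 = 7 by rfl,
    show (9 : ℕ) - 1 = 8 by rfl] at hl3 hl4 hl5 hl6 hl7 hl8 hl9
  linarith

end PercRepro.Shadow
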